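import Summits.QuantumFields.BalabanUV.Beta.GAN24.AveragedPropagatorOneStepCubic
import Summits.QuantumFields.BalabanUV.Beta.GAN24.AveragedPropagatorInverseOneStep
import Summits.QuantumFields.BalabanUV.Beta.GAN24.SoftVectorMinimiserTwoLevel

/-!
# G-an2-4 ∕ (CONV-C), road P2, VECTOR LAYER — THE SOFT COLUMN MAP `𝒢_kQ_k*` (Bałaban's `G_kQ_k* = H_k·(Q_kG_kQ_k*)`, the physical soft
# column of R7's chains) ACROSS ONE AVERAGING STEP: AN EXACT SPLIT `𝒢′Q′* − J𝒢Q* = (LOCAL part) + Π′·(𝒢′Q′* − J𝒢Q*)` WITH `Π′ = 𝒢′∂′R′∂′ᴴ`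
# AN OBLIQUE PROJECTION ONTO THE GAUGE-DEFECT RANGE; THE LOCAL PART OBEYS THE ONE-STEP SUP LAW (UNCONDITIONAL at `U = 1`, `a = 1`, cubic);
# THE GAUGE PART IS EXACTLY THE `H_k` ONE-STEP RATE — a LOCATED, PARTIAL answer to «INTERFACE REQUEST G-an2-4: (R7-HCONS)»

G-an2-4 formalisation swarm `b2b-balaban-gan24-formalise-*`, leaf prover 04 (gen 50), crux team (2) under the coordinator ruling «YM REDIRECT»
(e34b3e0c; FREEZE (0) honoured — a `GAN24/` module over EXISTING modules only, filed toward a crux prover's INTERFACE REQUEST: gan24-p3 gen 26,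
HOME/INBOX.md 2026-08-21 12:08Z «(R7-HCONS) `∃ δ summable, ‖colBG q (k+1) X′ − colBG q k (parT X′)‖ ≤ δ k` — the SUP-NORM ONE-STEP RATE of the
physical soft column at the block parent … located supplier road: p2's `SoftMinimiserOneStepSup` re-run on the vector carrier»).
WHAT THIS FILE SHOWS (every statement [folklore] algebra ∕ triangle inequalities over TREE theorems BY NAME — (1.95)∕(1.97)
`B5Identities197Torus.eq195_left ∕ eq195_right ∕ eq197_left` (lit-balaban p21), the road-P2 chair `b2b-balaban-gan24-p2` gen 30's Parts 2–6
(`StaircaseAveragingDefect`, `AveragedPropagatorTwoLevel`, `AveragedPropagatorDefectFields`, `AveragedPropagatorOneStepSup`, `…Cubic`), leaf-03 gen 50's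
`AveragedPropagatorInverseUniform.covOp_eq_QGQ`, the chair's Part 7 `isUnit_covOp_det`, the β cell's `FluctuationProjection.Hk` ∕ `QGQ_inv_mul`):
 * §1 `colOp n M a := (Δ_a)⁻¹·Q*` (the soft column map; `u_q = a·colOp·e_q` is R7's physical column), `projR n M a := (Δ_a)⁻¹·∂·RT·∂ᴴ` (`Π`);
   EXACT FACTS: **`locOp_mul_colOp : locOp·colOp = Q*`** (`Δ_a = locOp + ∂RT∂ᴴ` and (1.95) `RT∂ᴴ𝒢Q* = 0` — the column solves the LOCAL equation),
   `Π·Π = Π` (the chair's `projR_mul_projR`), **`projR_mul_colOp : Π·colOp = 0`** ((1.95) left, his `projR_mul_inv_mul_QvAdj`), **`QvOp_mul_projR :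
   Q·Π = 0`** ((1.95) right), `QvOp_mul_colOp : Q·colOp = covOp`, and **`colOp_eq_Hk_mul_covOp : colOp = H_k·covOp`** ((1.103): `𝒢Q* = H_k·(Q𝒢Q*)`).
 * §2 THE TWO-LEVEL IDENTITY OF THE COLUMN MAP (every `N, R ≥ 1`, torus, `a > 0`; `J = stairV` the componentwise staircase, `E₂ = adjDefect`,
   `𝔇 = locOp′J − J·locOp` the chair's LOCAL defect): **`colOp_succ_sub`**: `colOp′ − J·colOp = 𝒢′E₂ − 𝒢′𝔇·colOp − Π′·(J·colOp)`;
   `projR_mul_stairV_mul_colOp_eq_comm`: `Π′(J·colOp) = (Π′J − JΠ)·colOp` (a COMMUTATOR with the staircase);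
   **`one_sub_projR_mul_colOp_succ_sub`**: `(1 − Π′)·(colOp′ − J·colOp) = 𝒢′E₂ − 𝒢′𝔇·colOp` — the component of the one-step difference
   OFF the gauge-defect range `range Π′ ⊆ 𝒢′∂′(Δ′N(Q′))` is LOCAL; `QvOp_mul_colOp_succ_sub` recovers the chair's `covOp_succ_sub` (`Q′` kills `Π′`);
   and **`colOp_succ_sub_eq_Hk`**: `colOp′ − J·colOp = H′·(c′ − c) + (H′ − J·H)·c` — THE LOCATED EQUIVALENCE: modulo the tree's sup laws for
   `c′ − c` (p264926), `‖H‖_{∞→∞}` (p263836), `c⁻¹` (p265411, p266164), a sup one-step rate of the COLUMN is the same thing as a sup one-step rate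
   of Bałaban's HARD minimiser `H_k = 𝒢Q*(Q𝒢Q*)⁻¹` — the `H_k` constituent of (CONV-C) itself; from the hard side (exact):
   **`Hk_succ_sub_eq_colOp`**: `H′ − J·H = (colOp′ − J·colOp)·(c′)⁻¹ + (J·colOp)·((c′)⁻¹ − c⁻¹)` (the chair's located paragraph, INBOX l.8647, in kernel form).
 * §3 **`norm_localPart_mulVec_le_of_letters`** (every d, torus, `a > 0`): the local part in sup → sup currency MODULO the five vector letters
   (no outer `Q′`, no `E₁` term): `‖((𝒢′E₂ − 𝒢′𝔇·colOp)g)(x′)‖ ≤ ((R−1)∕(RN))·(2C₀′ + (d + d²)(C₃′C₂ + C₁′C₄) + 3aC₀′C₀)·|g|_∞`;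
   §4 **`norm_localPart_mulVec_le_cubic`**: UNCONDITIONAL at `a = 1` on cubic unit tori, `≤ K(d)·((R−1)∕(RN))·(2 + log RN + log N)·|g|_∞`.
WHY THE REQUESTED LETTER IS NOT HERE (located).  (R7-HCONS) is the sup smallness of the WHOLE difference; by §2 it is the sup smallness of
`Π′·(colOp′ − J·colOp) = −Π′J·colOp = −𝒢′∂′RT′·∂′ᴴ(J𝒢Q*)` — the level-`RN` gauge defect of the INTERPOLATED level-`N` column.  The chair's collapse
(`AveragedPropagatorTwoLevel.gauge_collapse`) needs `Q′` immediately LEFT of `𝒢′∂′RT′`; the bare column has none, and `RT′∂′ᴴJ` does not factor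
through `J·RT∂ᴴ` (the divergence of a componentwise staircase is face-supported).  So the scalar-prototype road (`SoftMinimiserOneStepSup`, no gauge
projection) does NOT transfer, and by `colOp_succ_sub_eq_Hk` the missing piece is the `H_k` one-step rate — crux-sized (the estimate B12 p. 264 defers
to «a separate paper»), not a leaf letter.  Nothing here claims it.
HONEST SCOPE.  `U = 1`; identities for every torus and `a > 0`; the unconditional bound at `a = 1`, CUBIC unit tori, sup → sup; constants EXISTENTIAL
(the suppliers'); [Balaban1984PropagatorsI] (1.95)∕(1.97)∕(1.103) pp. 34–35 and [Balaban1984PropagatorsII] (2.35) are TEXT LOCATIONS of TREE theorems,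
nothing printed is asserted; NOT (R7-HCONS), NOT (CONV-C) as typed, NEVER «G-an2-4 closed», NOT NE2 ∕ NE3, NOT D1, NOT BetaPertH, NOT continuum, NOT
Clay; 1 bookkeeping def (`colOp`; `Π = projR` is the chair's), 0 `def … : Prop`, 0 cite tag, no sorry — not in print, our bookkeeping.  HONEST DEPENDENCY: continuum YM
on T⁴ ⇐ BetaPertH ∧ nine spine estimates (0/9 proved); BetaPertH ⇐ (D1) ∧ (D4) ∧ CAP+tail; G-an2-4 gates asym, D1 and NE2/3/4.
-/

noncomputable section

open scoped BigOperators ComplexConjugate Matrix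

namespace Summit.QuantumFields.BalabanUV.Beta.GAN24.SoftColumnTwoLevel

open Literature.MathematicalPhysics.QuantumFieldTheory.Balaban1983to89
open B5Prop11Plancherel (Tor fine fdiff)
open B5Prop11Lower (Lap)
open B5Action121 (GradOp)
open B5Block118 (QvOp)
open B5DeltaA169 (DeltaA QvAdj isUnit_DeltaA calG_eq_DeltaA_inv)
open B5Identities197Torus (RT eq195_left eq195_right eq197_left)
open Beta.FluctuationProjection (Hk QGQ QGQ_inv_mul)
open Summit.QuantumFields.BalabanUV.Beta.GAN24.StaircaseAveragingDefect (stairV fwdDefect adjDefect ratio_nonneg norm_adjDefect_mulVec_le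
  norm_QvAdj_mulVec_le)
open Summit.QuantumFields.BalabanUV.Beta.GAN24.AveragedPropagatorTwoLevel (covOp locOp DeltaA_eq_locOp_add locOp_stairV_defect covOp_succ_sub)
open Summit.QuantumFields.BalabanUV.Beta.GAN24.AveragedPropagatorOneStepSup (norm_G_Lap_defect_le norm_G_gradDiv_defect_le norm_G_Pi_defect_le)
open Summit.QuantumFields.BalabanUV.Beta.GAN24.AveragedPropagatorOneStepCubic (exists_sup_inv_one)
open Summit.QuantumFields.BalabanUV.Beta.GAN24.AveragedPropagatorInverseUniform (covOp_eq_QGQ)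
open Summit.QuantumFields.BalabanUV.Beta.GAN24.AveragedPropagatorInverseOneStep (isUnit_covOp_det)
open Summit.QuantumFields.BalabanUV.Beta.GAN24.SoftVectorMinimiserTwoLevel (projR MsoftV projR_mul_projR projR_mul_inv_mul_QvAdj MsoftV_succ_sub)
open Summit.QuantumFields.BalabanUV.Beta.GAN24.Entry115SupCubic (norm_fdiff_inv_mulVec_le_cubic norm_inv_fdiffH_mulVec_le_cubic)
open Summit.QuantumFields.BalabanUV.Beta.GAN24.Entry112SupLogCubicFlat (sup112GradGrad_one_cubic sup112GDivDiv_one_cubic)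

variable {d : ℕ}

/-! ## §1 The column map, the gauge projection, and their exact laws -/

section OneLevel

variable (n : ℕ) [NeZero n] (M : Fin d → ℕ) [hM : ∀ μ, NeZero (M μ)] (a : ℝ)

/-- **the soft column map** `colOp n M a := 𝒢_n(a)·Q_n*` : unit-lattice bond fields → fine bond fields (`u_q = a·colOp·e_q` is R7's physical soft
column, Bałaban's `G_kQ_k*`). [folklore] -/
def colOp : Matrix (Tor (fine n M) × Fin d) (Tor M × Fin d) ℂ := (DeltaA n M a)⁻¹ * QvAdj n M

/-- `Q·colOp = covOp` (the chair's averaged propagator). [folklore] -/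
theorem QvOp_mul_colOp : QvOp n M * colOp n M a = covOp n M a := by
  rw [colOp, covOp, Matrix.mul_assoc]

/-- dictionary with the road-P2 chair's `SoftVectorMinimiserTwoLevel` (filed 17 minutes earlier, same session of the cell): his vector soft
minimiser is `MsoftV = a•colOp` and his R-longitudinal projector `projR = 𝒢·∂·RT·∂ᴴ` is used below BY NAME as the gauge-defect projection `Π`. [folklore] -/
theorem MsoftV_eq_smul_colOp : MsoftV n M a = (a : ℂ) • colOp n M a := rfl

/-- **THE COLUMN SOLVES THE LOCAL EQUATION**: `locOp·colOp = Q*` — from `Δ_a = locOp + ∂·RT·∂ᴴ` and (1.95) `RT·∂ᴴ·𝒢·Q* = 0`. [folklore] -/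
theorem locOp_mul_colOp (ha : 0 < a) : locOp n M a * colOp n M a = QvAdj n M := by
  have hn : 1 ≤ n := Nat.one_le_iff_ne_zero.mpr (NeZero.ne n)
  have hD : DeltaA n M a * (DeltaA n M a)⁻¹ = 1 :=
    Matrix.mul_nonsing_inv _ ((Matrix.isUnit_iff_isUnit_det _).mp (isUnit_DeltaA n hn M a ha))
  have hl := eq195_left n hn M a ha
  have e : locOp n M a = DeltaA n M a - GradOp (fine n M) (n : ℂ) * RT n M * (GradOp (fine n M) (n : ℂ))ᴴ := by
    rw [DeltaA_eq_locOp_add]; abel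
  rw [e, colOp, Matrix.sub_mul, ← Matrix.mul_assoc (DeltaA n M a), hD, Matrix.one_mul]
  have : GradOp (fine n M) (n : ℂ) * RT n M * (GradOp (fine n M) (n : ℂ))ᴴ * ((DeltaA n M a)⁻¹ * QvAdj n M)
      = GradOp (fine n M) (n : ℂ) * (RT n M * (GradOp (fine n M) (n : ℂ))ᴴ * (DeltaA n M a)⁻¹ * QvAdj n M) := by
    simp only [Matrix.mul_assoc]
  rw [this, hl, Matrix.mul_zero, sub_zero]

/-- **`Π·colOp = 0`** — (1.95) `RT·∂ᴴ·𝒢·Q* = 0`: the column is gauge-clean at its own level (the chair's `projR_mul_inv_mul_QvAdj` BY NAME). [folklore] -/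
theorem projR_mul_colOp (ha : 0 < a) : projR n M a * colOp n M a = 0 := by
  rw [colOp]; exact projR_mul_inv_mul_QvAdj n M a ha

/-- **`Q·Π = 0`** — (1.95) `Q·𝒢·∂·RT = 0`: the averaging kills the gauge-defect range (why `covOp` collapses). [folklore] -/
theorem QvOp_mul_projR (ha : 0 < a) : QvOp n M * projR n M a = 0 := by
  have hn : 1 ≤ n := Nat.one_le_iff_ne_zero.mpr (NeZero.ne n)
  have hr := eq195_right n hn M a ha
  calc QvOp n M * projR n M a
      = (QvOp n M * (DeltaA n M a)⁻¹ * GradOp (fine n M) (n : ℂ) * RT n M) * (GradOp (fine n M) (n : ℂ))ᴴ := by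
        simp only [projR, Matrix.mul_assoc]
    _ = 0 := by rw [hr, Matrix.zero_mul]

/-- **(1.103): `colOp = H_k·covOp`** — `𝒢Q* = H_k·(Q𝒢Q*)` with `H_k = 𝒢Q*(Q𝒢Q*)⁻¹` (`FluctuationProjection.Hk`, `QGQ_inv_mul`; `covOp = QGQ` by
leaf-03's `covOp_eq_QGQ`). [folklore] -/
theorem colOp_eq_Hk_mul_covOp (hn : 1 ≤ n) (ha : 0 < a) : colOp n M a = Hk n hn M a ha * covOp n M a := by
  have hQ : QvOp n M * B5Prop11Plancherel.calG n hn M a ha * QvAdj n M = QGQ n hn M a ha := rfl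
  rw [colOp, covOp, Hk, ← calG_eq_DeltaA_inv n hn M a ha, hQ, Matrix.mul_assoc (_ * QvAdj n M), QGQ_inv_mul, Matrix.mul_one]

/-- **`H_k = colOp·covOp⁻¹`** (`covOp` invertible by coercivity, the chair's `isUnit_covOp_det`). [folklore] -/
theorem Hk_eq_colOp_mul_covOp_inv (hn : 1 ≤ n) (ha : 0 < a) : Hk n hn M a ha = colOp n M a * (covOp n M a)⁻¹ := by
  rw [colOp_eq_Hk_mul_covOp n M a hn ha, Matrix.mul_assoc, Matrix.mul_nonsing_inv _ (isUnit_covOp_det n M ha), Matrix.mul_one]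

end OneLevel

/-! ## §2 The two-level identity of the column map and its split -/

section TwoLevel

variable (N R : ℕ) [NeZero N] [NeZero R] (M : Fin d → ℕ) [hM : ∀ μ, NeZero (M μ)] (a : ℝ)

/-- **THE TWO-LEVEL IDENTITY OF THE COLUMN MAP**: `colOp′ − J·colOp = 𝒢′E₂ − 𝒢′·(locOp′J − J·locOp)·colOp − Π′·(J·colOp)`
(`𝒢′Δ′_a = 1`, `Q′* = E₂ + JQ*`, `Q* = locOp·colOp`, `Δ′_a = locOp′ + ∂′RT′∂′ᴴ`). [folklore] -/
theorem colOp_succ_sub (ha : 0 < a) :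
    colOp (R * N) M a - stairV N R M * colOp N M a
      = (DeltaA (R * N) M a)⁻¹ * adjDefect N R M
        - (DeltaA (R * N) M a)⁻¹ * (locOp (R * N) M a * stairV N R M - stairV N R M * locOp N M a) * colOp N M a
        - projR (R * N) M a * (stairV N R M * colOp N M a) := by
  have hRN : 1 ≤ R * N := Nat.one_le_iff_ne_zero.mpr (NeZero.ne (R * N))
  have h1 : (DeltaA (R * N) M a)⁻¹ * DeltaA (R * N) M a = 1 :=
    Matrix.nonsing_inv_mul _ ((Matrix.isUnit_iff_isUnit_det _).mp (isUnit_DeltaA (R * N) hRN M a ha))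
  have hE2 : QvAdj (R * N) M = adjDefect N R M + stairV N R M * QvAdj N M := by rw [adjDefect]; abel
  have hloc := locOp_mul_colOp N M a ha
  have hΔ := DeltaA_eq_locOp_add (R * N) M a
  have hcol' : colOp (R * N) M a = (DeltaA (R * N) M a)⁻¹ * QvAdj (R * N) M := rfl
  have hPi : projR (R * N) M a
      = (DeltaA (R * N) M a)⁻¹ * (GradOp (fine (R * N) M) ((R * N : ℕ) : ℂ) * RT (R * N) M * (GradOp (fine (R * N) M) ((R * N : ℕ) : ℂ))ᴴ) := by
    simp only [projR, Matrix.mul_assoc]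
  rw [hPi, hcol', hE2]
  set G' := (DeltaA (R * N) M a)⁻¹ with hG'
  set J := stairV N R M
  set C := colOp N M a
  set A := adjDefect N R M
  set Lo' := locOp (R * N) M a
  set Lo := locOp N M a
  set P := GradOp (fine (R * N) M) ((R * N : ℕ) : ℂ) * RT (R * N) M * (GradOp (fine (R * N) M) ((R * N : ℕ) : ℂ))ᴴ
  set Δ' := DeltaA (R * N) M a
  set Qs := QvAdj N M
  clear_value G' J C A Lo' Lo P Δ' Qs
  subst hΔ
  -- now: G' * (A + J * Qs) - J * C = G' * A - G' * (Lo' * J - J * Lo) * C - G' * P * (J * C), with Lo * C = Qs, G' * (Lo' + P) = 1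
  have hJ : J * C = G' * ((Lo' + P) * (J * C)) := by rw [← Matrix.mul_assoc, h1, Matrix.one_mul]
  rw [← hloc]
  conv_lhs => rw [hJ]
  simp only [Matrix.mul_add, Matrix.add_mul, Matrix.mul_sub, Matrix.sub_mul, Matrix.mul_assoc]
  abel

/-- **THE GAUGE PART IS A PROJECTION OF THE DIFFERENCE ITSELF**: `Π′·(J·colOp) = −Π′·(colOp′ − J·colOp)` (`Π′·colOp′ = 0`). [folklore] -/
theorem projR_mul_stairV_mul_colOp (ha : 0 < a) :
    projR (R * N) M a * (stairV N R M * colOp N M a)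
      = -(projR (R * N) M a * (colOp (R * N) M a - stairV N R M * colOp N M a)) := by
  rw [Matrix.mul_sub, projR_mul_colOp (R * N) M a ha, zero_sub, neg_neg]

/-- **THE GAUGE PART IS A COMMUTATOR**: `Π′·(J·colOp) = (Π′·J − J·Π)·colOp` (`Π·colOp = 0` at level `N`) — the residual of (R7-HCONS) is the
commutator of the (a-independent, kinematic) gauge-defect projection with the staircase, applied to the column (gan24-idea-1 gen 9's reading
(ρ2-P), journal 2026-08-21 12:30Z). [folklore] -/
theorem projR_mul_stairV_mul_colOp_eq_comm (ha : 0 < a) :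
    projR (R * N) M a * (stairV N R M * colOp N M a)
      = (projR (R * N) M a * stairV N R M - stairV N R M * projR N M a) * colOp N M a := by
  rw [Matrix.sub_mul, Matrix.mul_assoc (stairV N R M), projR_mul_colOp N M a ha, Matrix.mul_zero, sub_zero, Matrix.mul_assoc]

/-- **THE SPLIT**: `(1 − Π′)·(colOp′ − J·colOp) = 𝒢′E₂ − 𝒢′·(locOp′J − J·locOp)·colOp` — the component of the column map's one-step difference OFF
the gauge-defect range `range Π′` is the LOCAL part (exact; every `N, R ≥ 1`, torus, `a > 0`). [folklore] -/
theorem one_sub_projR_mul_colOp_succ_sub (ha : 0 < a) :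
    (1 - projR (R * N) M a) * (colOp (R * N) M a - stairV N R M * colOp N M a)
      = (DeltaA (R * N) M a)⁻¹ * adjDefect N R M
        - (DeltaA (R * N) M a)⁻¹ * (locOp (R * N) M a * stairV N R M - stairV N R M * locOp N M a) * colOp N M a := by
  have h := colOp_succ_sub N R M a ha
  rw [projR_mul_stairV_mul_colOp N R M a ha] at h
  rw [Matrix.sub_mul, Matrix.one_mul]
  -- `D = L + Π′D` ⇒ `D − Π′D = L`
  set D := colOp (R * N) M a - stairV N R M * colOp N M a
  set L₁ := (DeltaA (R * N) M a)⁻¹ * adjDefect N R M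
  set L₂ := (DeltaA (R * N) M a)⁻¹ * (locOp (R * N) M a * stairV N R M - stairV N R M * locOp N M a) * colOp N M a
  set P := projR (R * N) M a * D
  clear_value D L₁ L₂ P
  nth_rewrite 1 [h]
  abel

/-- **CONSISTENCY WITH THE CHAIR's IDENTITY**: `Q′·(colOp′ − J·colOp) + E₁·colOp = covOp′ − covOp` (`Q′J = Q + E₁`; so `Q′` applied to §2 and
`Q′Π′ = 0` give back `AveragedPropagatorTwoLevel.covOp_succ_sub`). [folklore] -/
theorem QvOp_mul_colOp_succ_sub :
    QvOp (R * N) M * (colOp (R * N) M a - stairV N R M * colOp N M a) + fwdDefect N R M * colOp N M a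
      = covOp (R * N) M a - covOp N M a := by
  rw [← QvOp_mul_colOp (R * N) M a, ← QvOp_mul_colOp N M a, fwdDefect]
  simp only [Matrix.mul_sub, Matrix.sub_mul, Matrix.mul_assoc]
  abel

/-- **THE LOCATED EQUIVALENCE (exact)**: `colOp′ − J·colOp = H′·(covOp′ − covOp) + (H′ − J·H)·covOp` — a sup one-step rate of the COLUMN and a sup
one-step rate of the HARD minimiser `H_k` differ by terms the tree bounds (`covOp′ − covOp`: p264926; `‖H′‖`: p263836; `covOp` and its inverse:
p266003 ∕ p265411). [folklore] -/
theorem colOp_succ_sub_eq_Hk (ha : 0 < a) (hN : 1 ≤ N) (hRN : 1 ≤ R * N) :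
    colOp (R * N) M a - stairV N R M * colOp N M a
      = Hk (R * N) hRN M a ha * (covOp (R * N) M a - covOp N M a)
        + (Hk (R * N) hRN M a ha - stairV N R M * Hk N hN M a ha) * covOp N M a := by
  rw [colOp_eq_Hk_mul_covOp (R * N) M a hRN ha, colOp_eq_Hk_mul_covOp N M a hN ha]
  simp only [Matrix.mul_sub, Matrix.sub_mul, Matrix.mul_assoc]
  abel

/-- **THE SAME EQUIVALENCE FROM THE HARD SIDE (exact)**: `H′ − J·H = (colOp′ − J·colOp)·(covOp′)⁻¹ + (J·colOp)·((covOp′)⁻¹ − covOp⁻¹)` — the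
one-step difference of Bałaban's hard minimiser `H_k` IS the column map's, right-multiplied by the tree-bounded `(c′)⁻¹` (leaf-03's σ), plus a term
the tree bounds (the chair's Part 7 `(c′)⁻¹ − c⁻¹` law); the road-P2 chair's located paragraph (HOME/INBOX 2026-08-21 l.8647) in kernel form. [folklore] -/
theorem Hk_succ_sub_eq_colOp (ha : 0 < a) (hN : 1 ≤ N) (hRN : 1 ≤ R * N) :
    Hk (R * N) hRN M a ha - stairV N R M * Hk N hN M a ha
      = (colOp (R * N) M a - stairV N R M * colOp N M a) * (covOp (R * N) M a)⁻¹
        + stairV N R M * colOp N M a * ((covOp (R * N) M a)⁻¹ - (covOp N M a)⁻¹) := by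
  rw [Hk_eq_colOp_mul_covOp_inv (R * N) M a hRN ha, Hk_eq_colOp_mul_covOp_inv N M a hN ha]
  simp only [Matrix.mul_sub, Matrix.sub_mul, Matrix.mul_assoc]
  abel

end TwoLevel

/-! ## §3 The local part in sup → sup currency, modulo the five vector letters -/

section Letters

variable (N R : ℕ) [NeZero N] [NeZero R] (M : Fin d → ℕ) [hM : ∀ μ, NeZero (M μ)]

/-- **THE LOCAL PART OF THE COLUMN MAP's ONE-STEP DIFFERENCE, MODULO THE VECTOR LETTERS** (every `d`, torus, `a > 0`, `N, R ≥ 1`): given the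
sup → sup letters `C₀` (`𝒢_N`), `C₀′` (`𝒢_{RN}`), `C₁′` (`𝒢_{RN}∇ᴴ`), `C₂` (`∇𝒢_N`), `C₃′` (`𝒢_{RN}∇ᴴ∇ᴴ`), `C₄` (`∇∇𝒢_N`), for every unit bond field `g`
with `|g| ≤ b` and every fine bond `x′`:
`‖((𝒢′E₂ − 𝒢′𝔇·colOp)g)(x′)‖ ≤ ((R−1)∕(RN))·(2C₀′ + (d + d²)(C₃′C₂ + C₁′C₄) + 3aC₀′C₀)·b` — the chair's Part 5 term lemmas BY NAME, no outer `Q′`,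
no `E₁` term. [folklore] -/
theorem norm_localPart_mulVec_le_of_letters {a : ℝ} (ha : 0 < a) {C₀ C₀' C₁' C₂ C₃' C₄ : ℝ}
    (hG0 : ∀ (F : Tor (fine N M) × Fin d → ℂ) (B : ℝ), (∀ j, ‖F j‖ ≤ B) → ∀ i, ‖((DeltaA N M a)⁻¹ *ᵥ F) i‖ ≤ C₀ * B)
    (hG0' : ∀ (F : Tor (fine (R * N) M) × Fin d → ℂ) (B : ℝ), (∀ j, ‖F j‖ ≤ B) →
      ∀ i, ‖((DeltaA (R * N) M a)⁻¹ *ᵥ F) i‖ ≤ C₀' * B)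
    (hG1' : ∀ (ν : Fin d) (F : Tor (fine (R * N) M) × Fin d → ℂ) (B : ℝ), (∀ j, ‖F j‖ ≤ B) →
      ∀ i, ‖((DeltaA (R * N) M a)⁻¹ *ᵥ ((fdiff (fine (R * N) M) ((R * N : ℕ) : ℂ) ν)ᴴ *ᵥ F)) i‖ ≤ C₁' * B)
    (hG2 : ∀ (ν : Fin d) (F : Tor (fine N M) × Fin d → ℂ) (B : ℝ), (∀ j, ‖F j‖ ≤ B) →
      ∀ i, ‖(fdiff (fine N M) (N : ℂ) ν *ᵥ ((DeltaA N M a)⁻¹ *ᵥ F)) i‖ ≤ C₂ * B)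
    (hG3' : ∀ (μ ν : Fin d) (F : Tor (fine (R * N) M) × Fin d → ℂ) (B : ℝ), (∀ j, ‖F j‖ ≤ B) →
      ∀ i, ‖((DeltaA (R * N) M a)⁻¹ *ᵥ ((fdiff (fine (R * N) M) ((R * N : ℕ) : ℂ) μ)ᴴ *ᵥ
        ((fdiff (fine (R * N) M) ((R * N : ℕ) : ℂ) ν)ᴴ *ᵥ F))) i‖ ≤ C₃' * B)
    (hG4 : ∀ (μ ν : Fin d) (F : Tor (fine N M) × Fin d → ℂ) (B : ℝ), (∀ j, ‖F j‖ ≤ B) →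
      ∀ i, ‖(fdiff (fine N M) (N : ℂ) μ *ᵥ (fdiff (fine N M) (N : ℂ) ν *ᵥ ((DeltaA N M a)⁻¹ *ᵥ F))) i‖ ≤ C₄ * B)
    (g : Tor M × Fin d → ℂ) (b : ℝ) (hg : ∀ j, ‖g j‖ ≤ b) (i : Tor (fine (R * N) M) × Fin d) :
    ‖(((DeltaA (R * N) M a)⁻¹ * adjDefect N R M
        - (DeltaA (R * N) M a)⁻¹ * (locOp (R * N) M a * stairV N R M - stairV N R M * locOp N M a) * colOp N M a) *ᵥ g) i‖
      ≤ (((R : ℝ) - 1) / ((R : ℝ) * N)) * (2 * C₀' + ((d : ℝ) + d ^ 2) * (C₃' * C₂ + C₁' * C₄) + 3 * a * (C₀' * C₀)) * b := by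
  have hρ := ratio_nonneg N R
  set ρ : ℝ := ((R : ℝ) - 1) / ((R : ℝ) * N) with hρdef
  set G' := (DeltaA (R * N) M a)⁻¹
  set G := (DeltaA N M a)⁻¹
  -- the fine field `u = colOp g = 𝒢Q*g` and its letters
  set u : Tor (fine N M) × Fin d → ℂ := colOp N M a *ᵥ g with hu
  have hu' : u = G *ᵥ (QvAdj N M *ᵥ g) := by rw [hu, colOp, Matrix.mulVec_mulVec]
  have hQg : ∀ j, ‖(QvAdj N M *ᵥ g) j‖ ≤ b := norm_QvAdj_mulVec_le M N g b hg
  have hu0 : ∀ j, ‖u j‖ ≤ C₀ * b := by rw [hu']; exact hG0 _ _ hQg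
  have hu2 : ∀ ν j, ‖(fdiff (fine N M) (N : ℂ) ν *ᵥ u) j‖ ≤ C₂ * b := fun ν => by rw [hu']; exact hG2 ν _ _ hQg
  have hu4 : ∀ μ ν j, ‖(fdiff (fine N M) (N : ℂ) ν *ᵥ (fdiff (fine N M) (N : ℂ) μ *ᵥ u)) j‖ ≤ C₄ * b :=
    fun μ ν => by rw [hu']; exact hG4 ν μ _ _ hQg
  rw [Matrix.sub_mulVec, Pi.sub_apply]
  -- T1 = 𝒢′E₂g
  have hT1 : ‖((G' * adjDefect N R M) *ᵥ g) i‖ ≤ C₀' * (2 * ρ * b) := by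
    rw [← Matrix.mulVec_mulVec]
    exact hG0' _ _ (norm_adjDefect_mulVec_le N R M g b hg) i
  -- T3 = 𝒢′𝔇u
  have hT3 : ‖((G' * (locOp (R * N) M a * stairV N R M - stairV N R M * locOp N M a) * colOp N M a) *ᵥ g) i‖
      ≤ d * (ρ * (C₃' * (C₂ * b) + C₁' * (C₄ * b))) + ρ * (d * (d * (C₃' * (C₂ * b))) + d * (C₁' * (d * (C₄ * b))))
        + a * (3 * (ρ * (C₀' * (C₀ * b)))) := by
    rw [← Matrix.mulVec_mulVec, ← Matrix.mulVec_mulVec, ← hu, locOp_stairV_defect]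
    rw [Matrix.add_mulVec, Matrix.sub_mulVec, Matrix.smul_mulVec, Matrix.mulVec_add, Matrix.mulVec_sub, Matrix.mulVec_smul,
      Pi.add_apply, Pi.sub_apply, Pi.smul_apply]
    refine norm_add_le_of_le (norm_sub_le_of_le ?_ ?_) ?_
    · exact norm_G_Lap_defect_le N R M G' hG1' hG3' u (fun ν => hu2 ν) (fun ν => hu4 ν ν) i
    · exact norm_G_gradDiv_defect_le N R M G' hG1' hG3' u hu2 hu4 i
    · rw [norm_smul, Complex.norm_real, Real.norm_of_nonneg ha.le]
      exact mul_le_mul_of_nonneg_left (norm_G_Pi_defect_le N R M G' hG0' u hu0 i) ha.le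
  calc _ ≤ C₀' * (2 * ρ * b)
        + (d * (ρ * (C₃' * (C₂ * b) + C₁' * (C₄ * b))) + ρ * (d * (d * (C₃' * (C₂ * b))) + d * (C₁' * (d * (C₄ * b))))
            + a * (3 * (ρ * (C₀' * (C₀ * b))))) := norm_sub_le_of_le hT1 hT3
    _ = ρ * (2 * C₀' + ((d : ℝ) + d ^ 2) * (C₃' * C₂ + C₁' * C₄) + 3 * a * (C₀' * C₀)) * b := by ring

end Letters

/-! ## §4 At `a = 1` on cubic unit tori: the local part is unconditionally small -/

/-- **THE LOCAL PART OF THE SOFT COLUMN's ONE-STEP DIFFERENCE AT `U = 1`, `a = 1`, ON EVERY CUBIC UNIT TORUS — UNCONDITIONAL**: `∃ K(d) > 0` with, for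
all `N, R, N₀ ≥ 1`, every `|g| ≤ b` and every fine bond `x′`,
`‖(((1 − Π′)·(colOp′ − J·colOp))g)(x′)‖ ≤ K·((R−1)∕(RN))·(2 + log RN + log N)·b` — the five letters BY NAME as in the chair's Part 6. [folklore] -/
theorem norm_localPart_mulVec_le_cubic (d : ℕ) :
    ∃ K : ℝ, 0 < K ∧ ∀ (N R N₀ : ℕ) [NeZero N] [NeZero R] [NeZero N₀]
      (g : Tor (fun _ : Fin (d + 1) => N₀) × Fin (d + 1) → ℂ) (b : ℝ), (∀ j, ‖g j‖ ≤ b) →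
        ∀ i : Tor (fine (R * N) (fun _ : Fin (d + 1) => N₀)) × Fin (d + 1),
          ‖(((1 - projR (R * N) (fun _ : Fin (d + 1) => N₀) 1)
              * (colOp (R * N) (fun _ : Fin (d + 1) => N₀) 1 - stairV N R (fun _ : Fin (d + 1) => N₀) * colOp N (fun _ : Fin (d + 1) => N₀) 1))
              *ᵥ g) i‖
            ≤ K * (((R : ℝ) - 1) / ((R : ℝ) * N)) * (2 + Real.log ((R * N : ℕ) : ℝ) + Real.log (N : ℝ)) * b := by
  obtain ⟨C₀, hC₀, h0⟩ := exists_sup_inv_one d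
  obtain ⟨C₁, hC₁, h1⟩ := norm_inv_fdiffH_mulVec_le_cubic (d := d)
  obtain ⟨C₂, hC₂, h2⟩ := norm_fdiff_inv_mulVec_le_cubic (d := d)
  obtain ⟨C₃, hC₃, h3⟩ := sup112GDivDiv_one_cubic (d := d)
  obtain ⟨C₄, hC₄, h4⟩ := sup112GradGrad_one_cubic (d := d)
  refine ⟨2 * C₀ + 3 * (C₀ * C₀) + (((d + 1 : ℕ) : ℝ) + ((d + 1 : ℕ) : ℝ) ^ 2) * (C₃ * C₂ + C₁ * C₄) + 1, by positivity, ?_⟩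
  intro N R N₀ _ _ _ g b hg i
  have hN : 1 ≤ N := Nat.one_le_iff_ne_zero.mpr (NeZero.ne N)
  have hRN : 1 ≤ R * N := Nat.one_le_iff_ne_zero.mpr (NeZero.ne (R * N))
  have hlN : 0 ≤ Real.log (N : ℝ) := Real.log_nonneg (by exact_mod_cast hN)
  have hlRN : 0 ≤ Real.log ((R * N : ℕ) : ℝ) := Real.log_nonneg (by exact_mod_cast hRN)
  have hb : 0 ≤ b := (norm_nonneg _).trans (hg ((fun _ => 0), 0))
  have hρ := ratio_nonneg N R
  rw [one_sub_projR_mul_colOp_succ_sub N R (fun _ : Fin (d + 1) => N₀) 1 one_pos]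
  have key := norm_localPart_mulVec_le_of_letters N R (fun _ : Fin (d + 1) => N₀) one_pos
    (C₀ := C₀) (C₀' := C₀) (C₁' := C₁) (C₂ := C₂) (C₃' := C₃ * (1 + Real.log ((R * N : ℕ) : ℝ))) (C₄ := C₄ * (1 + Real.log (N : ℝ)))
    (fun F B hF j => h0 N _ F B hF j) (fun F B hF j => h0 (R * N) _ F B hF j)
    (fun ν F B hF j => h1 (R * N) N₀ ν F B hF j) (fun ν F B hF j => h2 N N₀ ν F B hF j)
    (fun μ ν F B hF j => h3 (R * N) N₀ hRN μ ν F B hF j) (fun μ ν F B hF j => h4 N N₀ hN μ ν F B hF j) g b hg i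
  have hDD : 0 ≤ ((d + 1 : ℕ) : ℝ) + ((d + 1 : ℕ) : ℝ) ^ 2 := by positivity
  have e1 : C₃ * (1 + Real.log ((R * N : ℕ) : ℝ)) * C₂ ≤ C₃ * C₂ * (2 + Real.log ((R * N : ℕ) : ℝ) + Real.log (N : ℝ)) := by
    rw [mul_right_comm]; exact mul_le_mul_of_nonneg_left (by linarith) (by positivity)
  have e2 : C₁ * (C₄ * (1 + Real.log (N : ℝ))) ≤ C₁ * C₄ * (2 + Real.log ((R * N : ℕ) : ℝ) + Real.log (N : ℝ)) := by
    rw [← mul_assoc]; exact mul_le_mul_of_nonneg_left (by linarith) (by positivity)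
  have hX : 2 * C₀ + (((d + 1 : ℕ) : ℝ) + ((d + 1 : ℕ) : ℝ) ^ 2)
        * (C₃ * (1 + Real.log ((R * N : ℕ) : ℝ)) * C₂ + C₁ * (C₄ * (1 + Real.log (N : ℝ)))) + 3 * 1 * (C₀ * C₀)
      ≤ (2 * C₀ + 3 * (C₀ * C₀) + (((d + 1 : ℕ) : ℝ) + ((d + 1 : ℕ) : ℝ) ^ 2) * (C₃ * C₂ + C₁ * C₄) + 1)
        * (2 + Real.log ((R * N : ℕ) : ℝ) + Real.log (N : ℝ)) := by
    have h3C : 2 * C₀ + 3 * 1 * (C₀ * C₀) ≤ (2 * C₀ + 3 * (C₀ * C₀)) * (2 + Real.log ((R * N : ℕ) : ℝ) + Real.log (N : ℝ)) := by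
      have : 0 ≤ 2 * C₀ + 3 * (C₀ * C₀) := by positivity
      nlinarith
    have h4C : (((d + 1 : ℕ) : ℝ) + ((d + 1 : ℕ) : ℝ) ^ 2)
          * (C₃ * (1 + Real.log ((R * N : ℕ) : ℝ)) * C₂ + C₁ * (C₄ * (1 + Real.log (N : ℝ))))
        ≤ (((d + 1 : ℕ) : ℝ) + ((d + 1 : ℕ) : ℝ) ^ 2) * ((C₃ * C₂ + C₁ * C₄) * (2 + Real.log ((R * N : ℕ) : ℝ) + Real.log (N : ℝ))) :=
      mul_le_mul_of_nonneg_left (by rw [add_mul]; exact add_le_add e1 e2) hDD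
    nlinarith
  calc _ ≤ _ := key
    _ ≤ (((R : ℝ) - 1) / ((R : ℝ) * N))
          * ((2 * C₀ + 3 * (C₀ * C₀) + (((d + 1 : ℕ) : ℝ) + ((d + 1 : ℕ) : ℝ) ^ 2) * (C₃ * C₂ + C₁ * C₄) + 1)
            * (2 + Real.log ((R * N : ℕ) : ℝ) + Real.log (N : ℝ))) * b :=
        mul_le_mul_of_nonneg_right (mul_le_mul_of_nonneg_left hX hρ) hb
    _ = _ := by ring

end Summit.QuantumFields.BalabanUV.Beta.GAN24.SoftColumnTwoLevel

end
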